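/-
Copyright (c) 2026 the pub-hodgecm-mathlib formalisation cell (harness21).  Seat LD2-p01 (g5), brick (δ) of ROAD O («orthogonal copy»), 2026-09-02.
-/
import Summits.HodgeConjecture.HodgeConjecture.Theorems.F0LD2ThetaFinComponent
import HarnessLib

-- As in the lineage (`F0LD2ThetaFinComponent`): statements over the theta-kernel datum elaborate to very large types; elaborate sequentially.
set_option Elab.async false

/-!
# Crux `HLiu418`, LD lines, ROAD O brick (δ) — organ B₂ `ThetaFinComponent₂` WITHOUT the Hodge type

Cell hodgecm-mathlib (D-0151), FLOOR 0; crux item `HLiu418` = stmt-HodgeConjecture-24832 (socket `Cruxes/HLiu418/Lines/F0_AlbCm.lean`, `stub_S1b_facts` ∕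
`stub_S1_facts`); half-A lines LD1∕LD2.  Seat LD2-p01 (g5).  THEOREMS ONLY (no `def`, no instance, no notation, no named fact, no `sorry`);
`--supports stmt-HodgeConjecture-24832 --as helper`.

WHAT.  ★ `F0LD2ThetaFinComponent.thetaFinComponent₂_holds` (organ B₂ of line LD2, node B of [Liu2021, proof of Prop. 4.13 Case 1] at `n = 2`) uses its
Hodge-type binder `P.IsHolCotangentAt₂ … 𝔣` at exactly ONE point: through ★ `F0LD2CurveHolCotFormsArchCentre.centralCharacter_archCentre_eq_one₂` the
ARCHIMEDEAN CENTRE `(y,1)·1₂` (`y ∈ U(1)(L⁺ ⊗ ℝ)`) fixes `P` pointwise, so the theta character read off `P` (★ `F0LD2ThetaChiDescent` §1) is `1` on the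
archimedean torus and descends to Liu's `χ′ ∈ Chi` (★ `Def411WeilCarriers.exists_chi_chiQuot_eq_of_archUnit`).  This file re-runs B₂ from that weaker
hypothesis ALONE: §1 `charCM_archCentre_eq_one_of_archCentre_fixed` ∕ `exists_chi_chiQuot_eq_of_archCentre_fixed` (generic rank `N`; Hodge-free twins of
★ `F0LD2ThetaChiDescent` §2); §2 `exists_chi_starProjection_ne_zero_of_archCentre_fixed` (generic rank `N`; packaged with the seam `MeetsThetaLiftFromLine`);
§3 `thetaFinComponent₂_of_archCentre_fixed` (`N = 2`) — the body of ★ `thetaFinComponent₂_holds` with the binders `(𝔣 : ConeFrame …)`, `(∃ T, … = diag (1,-1))`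
dropped and `P.IsHolCotangentAt₂ … 𝔣` REPLACED by «the archimedean centre fixes `P` pointwise»; conclusion token for token
(`∃ χ′ ∈ Chi, ω(μ′, ε_{a′}, χ′)_f ≠ 0 ∧ P.HasFinComponent (ω(μ′, ε_{a′}, χ′)_f ∘ (finAdelicCongr … g ht hg).symm)`); B₂'s steps 1–2 and 5 verbatim.
WHY (ROAD O = [Liu2021, proof of Cor. B.6 (3)] with an ORTHOGONAL second realisation; LD1-p01 (g5) memo `F0/P6/LD/LD1-p01/g5/ROAD-O-orthogonal-copy.v1`).
The θ-type finite component must be read on closed theta spans `Q̄(a′,ξ)` and on an orthogonal copy `Q′` of a holomorphic `P`, neither known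
`IsHolCotangentAt₂` (a function-level predicate); both are unitarily equivalent to `P` inside `L²([U(H)])`, so the centre acts on them through `P`'s central
character (brick (η)), trivial on the archimedean centre (★ above) — exactly the hypothesis of §3.  No Hodge type, cone frame or signature binder is consumed.

HONEST LABEL: HC_CM is proved only modulo the 7 printed citations (2 remaining: hLiu418 = stmt-HodgeConjecture-24832, h413 = stmt-HodgeConjecture-24833)
until rung 0 closes; this file discharges none of them (in-house helper toward the LD lines; count-neutral).

## References
* [Liu2021] Y. Liu, Camb. J. Math. 9 (2021) = arXiv:2102.11518: Def. 4.11 (l. 2090–2096, p. 46); proof of Prop. 4.13 Case 1 (l. 2131–2137, p. 48);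
  App. B Cor. B.6 (3) and its proof (p. 99); App. D Lemma D.1 (l. 5227), proof of Prop. D.4 (1) (p. 131).
* [Rallis1984] Compositio Math. 51 (1984), Thm. 1.2.2 p. 356; [GelbartRogawski1991] Invent. Math. 105, §3.1–3.2 p. 457; [BorelJacquet1979] PSPM 33.1, §4.6.
-/

set_option autoImplicit false
-- the mandated namespace has the single-problem summit's repeated segment (`HodgeConjecture.HodgeConjecture`)
set_option linter.dupNamespace false
noncomputable section

open NumberField NumberField.InfinitePlace MeasureTheory IsDedekindDomain
open scoped Matrix Kronecker ComplexOrder ENNReal SchwartzMap TensorProduct Classical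

namespace Summit.HodgeConjecture.HodgeConjecture.Cruxes.HLiu418.F0LD2ThetaFinComponentOfArchCentre

open _root_.MeasureTheory
open Literature.NumberTheory.Automorphic Literature.NumberTheory.Automorphic.UnitaryGroup
open Literature.NumberTheory.Automorphic.UnitaryGroup.CotangentForms
open Literature.NumberTheory.Automorphic.UnitaryCurveForms
open Literature.NumberTheory.Automorphic.IdeleClassGroup
open Literature.NumberTheory.Automorphic.Liu2021
open Literature.NumberTheory.Automorphic.Liu2021.Def411WeilCarriers
open Literature.NumberTheory.Automorphic.Liu2021.Def411WeilCarriersDoubling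
open Literature.NumberTheory.GelbartRogawski1991 Literature.NumberTheory.GelbartRogawski1991.UnitaryDualPair
open Literature.NumberTheory.GelbartRogawski1991.UnitaryDualPair.WeilCoinv
open Literature.NumberTheory.Weil1964
open Literature.RepresentationTheory Literature.RepresentationTheory.Liu2021
open Literature.RepresentationTheory.CompactGroups
open Literature.RepresentationTheory.HeisenbergGroup
open Summit.HodgeConjecture.HodgeConjecture.Cruxes.HLiu418.F0LD1ThetaTransportKit
open Summit.HodgeConjecture.HodgeConjecture.Cruxes.HLiu418.F0LD2ThetaTensorClasses
open Summit.HodgeConjecture.HodgeConjecture.Cruxes.HLiu418.F0LD2ThetaFinIntertwiner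
open Summit.HodgeConjecture.HodgeConjecture.Cruxes.HLiu418.F0LD2ThetaChiDescent
open Summit.HodgeConjecture.HodgeConjecture.Cruxes.HLiu418.F0LD2ThetaSeamCharacter
open Summit.HodgeConjecture.HodgeConjecture.Cruxes.HLiu418.F0LD2FrameTransportPin

/-! ## §1 «`χ_∞ = 1`» and the descent `χ̃ ↦ χ′ ∈ Chi` for a discrete `P` FIXED BY THE ARCHIMEDEAN CENTRE (generic rank `N`) -/

section ArchCentre

variable (L : Type) [Field L] [NumberField L] [IsCMField L] (N : ℕ) (H : Matrix (Fin N) (Fin N) L)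
  {n' : ℕ} (e₁ : Fin N × Fin 1 ≃ Fin n') (dV : Fin N → L) (hdV : ∀ i, IsCMField.complexConj L (dV i) = dV i)
  (hdV0 : ∀ i, dV i ≠ 0) (g : GL (Fin N) L)
  (μ : Literature.NumberTheory.Automorphic.IdeleClassGroup L →ₜ* Circle) (hμ : IsConjugateSymplectic L μ) (a : (↥(maximalRealSubfield L))ˣ)
  (hρ : HasThetaMajorants fun
      (p : ↥(UnitaryGroup.adelic (↥(maximalRealSubfield L)) L (IsCMField.complexConj L) N (Matrix.diagonal dV)) ×
        ↥(UnitaryGroup.adelic (↥(maximalRealSubfield L)) L (IsCMField.complexConj L) 1 (JW (↥(maximalRealSubfield L)) L a)))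
      (Φ : piSchwartzBruhat (↥(maximalRealSubfield L)) (Fin n')) =>
        (pairRep (↥(maximalRealSubfield L)) L (IsCMField.complexConj L) N 1 e₁ (Matrix.diagonal dV) (JW (↥(maximalRealSubfield L)) L a)
          (chiSplittingLine L e₁ dV hdV hdV0 (toHeckeCharacter L μ) (isUnitary_toHeckeCharacter L μ)
            ((isOscillatorChar_toHeckeCharacter_iff μ).mpr hμ) (TW (↥(maximalRealSubfield L)) a)
            (isUnit_det_TW (↥(maximalRealSubfield L)) a) (JW (↥(maximalRealSubfield L)) L a) (JW_eq (↥(maximalRealSubfield L)) L a))) p Φ)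
  (ιA : (adelicGroupData (↥(maximalRealSubfield L)) L (IsCMField.complexConj L) N H).Adelic →*
    ↥(UnitaryGroup.adelic (↥(maximalRealSubfield L)) L (IsCMField.complexConj L) N (Matrix.diagonal dV)))
  (hιA : ∀ k, ((ιA k : ↥(UnitaryGroup.adelic (↥(maximalRealSubfield L)) L (IsCMField.complexConj L) N (Matrix.diagonal dV))) :
      GL (Fin N) (AdeleRing (𝓞 L) L)) =
    (toAdeleGL L g)⁻¹ * adelicVal (↥(maximalRealSubfield L)) L (IsCMField.complexConj L) N H k * toAdeleGL L g)
  (hιArat : ∀ γ : (adelicGroupData (↥(maximalRealSubfield L)) L (IsCMField.complexConj L) N H).Rational,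
    ιA ((adelicGroupData (↥(maximalRealSubfield L)) L (IsCMField.complexConj L) N H).toAdelic γ) ∈
      (UnitaryGroup.toAdelic (↥(maximalRealSubfield L)) L (IsCMField.complexConj L) N (Matrix.diagonal dV)).range)

variable
  [CompactSpace (↥(UnitaryGroup.adelic (↥(maximalRealSubfield L)) L (IsCMField.complexConj L) N (Matrix.diagonal dV)) ⧸
    (UnitaryGroup.toAdelic (↥(maximalRealSubfield L)) L (IsCMField.complexConj L) N (Matrix.diagonal dV)).range)]
  [MeasurableSpace (↥(UnitaryGroup.adelic (↥(maximalRealSubfield L)) L (IsCMField.complexConj L) 1 (JW (↥(maximalRealSubfield L)) L a)) ⧸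
    (UnitaryGroup.toAdelic (↥(maximalRealSubfield L)) L (IsCMField.complexConj L) 1 (JW (↥(maximalRealSubfield L)) L a)).range)]
  (μW : Measure (↥(UnitaryGroup.adelic (↥(maximalRealSubfield L)) L (IsCMField.complexConj L) 1 (JW (↥(maximalRealSubfield L)) L a)) ⧸
    (UnitaryGroup.toAdelic (↥(maximalRealSubfield L)) L (IsCMField.complexConj L) 1 (JW (↥(maximalRealSubfield L)) L a)).range))
  (Ψ : piSchwartzBruhat (↥(maximalRealSubfield L)) (Fin n'))
  [BorelSpace (↥(UnitaryGroup.adelic (↥(maximalRealSubfield L)) L (IsCMField.complexConj L) 1 (JW (↥(maximalRealSubfield L)) L a)) ⧸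
    (UnitaryGroup.toAdelic (↥(maximalRealSubfield L)) L (IsCMField.complexConj L) 1 (JW (↥(maximalRealSubfield L)) L a)).range)]
  [IsFiniteMeasure μW]
  [SMulInvariantMeasure
    ↥(UnitaryGroup.adelic (↥(maximalRealSubfield L)) L (IsCMField.complexConj L) 1 (JW (↥(maximalRealSubfield L)) L a))
    (↥(UnitaryGroup.adelic (↥(maximalRealSubfield L)) L (IsCMField.complexConj L) 1 (JW (↥(maximalRealSubfield L)) L a)) ⧸
      (UnitaryGroup.toAdelic (↥(maximalRealSubfield L)) L (IsCMField.complexConj L) 1 (JW (↥(maximalRealSubfield L)) L a)).range) μW]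
  (ν : Measure (adelicGroupData (↥(maximalRealSubfield L)) L (IsCMField.complexConj L) N H).automorphicQuotient)
  [(adelicGroupData (↥(maximalRealSubfield L)) L (IsCMField.complexConj L) N H).IsAutomorphicMeasure ν]

include hιA hιArat

set_option maxHeartbeats 1600000 in
/-- **«`χ_∞ = 1`» for the theta character of a discrete `P` FIXED BY THE ARCHIMEDEAN CENTRE** (Hodge-free twin of ★
`F0LD2ThetaChiDescent.charCM_archCentre_eq_one_of_holCotForm₂`): if the archimedean central elements `(y,1)·1_N` (`y ∈ U(1)(L⁺ ⊗ ℝ)`) fix the discrete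
`P` pointwise and `pr_P [Θ̃_Ψ(ξ) ∘ ιA] ≠ 0`, then `ξ([(y,1)·1_W]) = 1` — ★ `F0LD2ThetaChiDescent` §1 (`ξ([u·1_W]) = ψ_P(u)`) and `ψ_P((y,1)) = 1`, read on
the non-zero vector `pr_P [Θ̃_Ψ(ξ) ∘ ιA] ∈ P`. [cite: Liu2021, proof of Prop. 4.13 Case 1 l. 2137; App. B proof of Cor. B.6 (3) (p. 99)] [cite: BorelJacquet1979, §4.6] -/
theorem charCM_archCentre_eq_one_of_archCentre_fixed
    (P : DiscreteAutomorphicRep (adelicGroupData (↥(maximalRealSubfield L)) L (IsCMField.complexConj L) N H) ν)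
    (harch : ∀ (y : ↥(relNormOneInfUnits (↥(maximalRealSubfield L)) L)) (v : P.space.toSubmodule),
      P.space.toContRep (adelicCenter (↥(maximalRealSubfield L)) L (IsCMField.complexConj L) N H
        ((cmAdelicOneEquivRelNormOne L).symm (relNormOneInfToIdeles (↥(maximalRealSubfield L)) L y))) v = v) :
    haveI := normal_range_toAdelic_JW L a
    ∀ (ξ : PontryaginDual (↥(UnitaryGroup.adelic (↥(maximalRealSubfield L)) L (IsCMField.complexConj L) 1 (JW (↥(maximalRealSubfield L)) L a)) ⧸
        (UnitaryGroup.toAdelic (↥(maximalRealSubfield L)) L (IsCMField.complexConj L) 1 (JW (↥(maximalRealSubfield L)) L a)).range))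
      (hθ : MemLp (toQuotFun (adelicGroupData (↥(maximalRealSubfield L)) L (IsCMField.complexConj L) N H) fun x =>
        (lineThetaKernelDatum L N e₁ dV hdV hdV0 μ hμ a hρ).thetaLiftFun μW Ψ (charCM ξ) (ιA x)) 2 ν),
      P.space.toSubmodule.starProjection (MemLp.toLp _ hθ) ≠ 0 →
      ∀ y : ↥(relNormOneInfUnits (↥(maximalRealSubfield L)) L),
        ξ (QuotientGroup.mk (adelicCenter (↥(maximalRealSubfield L)) L (IsCMField.complexConj L) 1 (JW (↥(maximalRealSubfield L)) L a)
          ((cmAdelicOneEquivRelNormOne L).symm (relNormOneInfToIdeles (↥(maximalRealSubfield L)) L y)))) = 1 := by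
  haveI := normal_range_toAdelic_JW L a
  intro ξ hθ hpr y
  obtain ⟨ψ, -, -, -, hψ⟩ := P.exists_centralCharacter_adelicCenter
  set u := (cmAdelicOneEquivRelNormOne L).symm (relNormOneInfToIdeles (↥(maximalRealSubfield L)) L y) with hu
  -- `ψ(u) = ξ([u·1_W])` (§1 of ★ `F0LD2ThetaChiDescent`)
  have h1 := centralCharacter_eq_charCM_of_starProjection_ne_zero L N H e₁ dV hdV hdV0 g μ hμ a hρ ιA hιA hιArat μW Ψ ν P hψ ξ hθ hpr u
  -- `ψ(u) = 1`, read on the non-zero vector `w := pr_P [Θ̃_Ψ(ξ) ∘ ιA] ∈ P`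
  set w := P.space.toSubmodule.starProjection (MemLp.toLp _ hθ) with hw
  have hwmem : w ∈ P.space.toSubmodule := Submodule.starProjection_apply_mem _ _
  have hne' : (⟨w, hwmem⟩ : P.space.toSubmodule) ≠ 0 := fun h0 => hpr (congrArg Subtype.val h0)
  have hh := hψ u ⟨w, hwmem⟩
  rw [harch y ⟨w, hwmem⟩] at hh
  have h' : ((ψ u : ℂˣ) : ℂ) • (⟨w, hwmem⟩ : P.space.toSubmodule) = (1 : ℂ) • ⟨w, hwmem⟩ := by
    rw [one_smul]; exact hh.symm
  have h2 : ψ u = 1 := Units.ext (smul_left_injective ℂ hne' h')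
  apply Circle.ext
  rw [← h1, h2, Units.val_one, Circle.coe_one]

set_option maxHeartbeats 1600000 in
/-- **The theta character of a discrete `P` fixed by the archimedean centre descends to Liu's `χ′ ∈ Chi`** (Hodge-free twin of ★
`F0LD2ThetaChiDescent.exists_chi_chiQuot_eq_of_holCotForm₂`; ★ `Def411WeilCarriers.exists_chi_chiQuot_eq_of_archUnit`): `ξ = chiQuot a χ′` for some
`χ′ ∈ Chi L⁺ L c̄`. [cite: Liu2021, proof of Prop. 4.13 Case 1 (l. 2136–2137); Def. 4.11 (l. 2090)] [cite: BorelJacquet1979, §4.6] -/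
theorem exists_chi_chiQuot_eq_of_archCentre_fixed
    (P : DiscreteAutomorphicRep (adelicGroupData (↥(maximalRealSubfield L)) L (IsCMField.complexConj L) N H) ν)
    (harch : ∀ (y : ↥(relNormOneInfUnits (↥(maximalRealSubfield L)) L)) (v : P.space.toSubmodule),
      P.space.toContRep (adelicCenter (↥(maximalRealSubfield L)) L (IsCMField.complexConj L) N H
        ((cmAdelicOneEquivRelNormOne L).symm (relNormOneInfToIdeles (↥(maximalRealSubfield L)) L y))) v = v) :
    haveI := normal_range_toAdelic_JW L a
    ∀ (ξ : PontryaginDual (↥(UnitaryGroup.adelic (↥(maximalRealSubfield L)) L (IsCMField.complexConj L) 1 (JW (↥(maximalRealSubfield L)) L a)) ⧸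
        (UnitaryGroup.toAdelic (↥(maximalRealSubfield L)) L (IsCMField.complexConj L) 1 (JW (↥(maximalRealSubfield L)) L a)).range))
      (hθ : MemLp (toQuotFun (adelicGroupData (↥(maximalRealSubfield L)) L (IsCMField.complexConj L) N H) fun x =>
        (lineThetaKernelDatum L N e₁ dV hdV hdV0 μ hμ a hρ).thetaLiftFun μW Ψ (charCM ξ) (ιA x)) 2 ν),
      P.space.toSubmodule.starProjection (MemLp.toLp _ hθ) ≠ 0 →
      ∃ χ' : Chi (↥(maximalRealSubfield L)) L (IsCMField.complexConj L),
        chiQuot (↥(maximalRealSubfield L)) L (IsCMField.complexConj L) (Algebra.IsQuadraticExtension.finrank_eq_two _ L)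
          (IsCMField.complexConj_ne_one (K := L)) a χ' = ξ := by
  haveI := normal_range_toAdelic_JW L a
  intro ξ hθ hpr
  exact Def411WeilCarriers.exists_chi_chiQuot_eq_of_archUnit (↥(maximalRealSubfield L)) L (IsCMField.complexConj L) _ _ a ξ
    (charCM_archCentre_eq_one_of_archCentre_fixed L N H e₁ dV hdV hdV0 g μ hμ a hρ ιA hιA hιArat μW Ψ ν P harch ξ hθ hpr)

end ArchCentre
/-! ## §2 Packaged with the seam `MeetsThetaLiftFromLine` (generic rank `N`) -/

section Seam

variable (L : Type) [Field L] [NumberField L] [IsCMField L] (N : ℕ) (H : Matrix (Fin N) (Fin N) L)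
  {n' : ℕ} (e₁ : Fin N × Fin 1 ≃ Fin n') (dV : Fin N → L) (hdV : ∀ i, IsCMField.complexConj L (dV i) = dV i)
  (hdV0 : ∀ i, dV i ≠ 0) (g : GL (Fin N) L)
  (ιA : (adelicGroupData (↥(maximalRealSubfield L)) L (IsCMField.complexConj L) N H).Adelic →*
    ↥(UnitaryGroup.adelic (↥(maximalRealSubfield L)) L (IsCMField.complexConj L) N (Matrix.diagonal dV)))
  (hιA : Continuous ιA ∧ ∀ ⦃γ : (adelicGroupData (↥(maximalRealSubfield L)) L (IsCMField.complexConj L) N H).Adelic⦄,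
    γ ∈ (UnitaryGroup.toAdelic (↥(maximalRealSubfield L)) L (IsCMField.complexConj L) N H).range →
      ιA γ ∈ (UnitaryGroup.toAdelic (↥(maximalRealSubfield L)) L (IsCMField.complexConj L) N (Matrix.diagonal dV)).range)
  (hpin : ∀ k, ((ιA k : ↥(UnitaryGroup.adelic (↥(maximalRealSubfield L)) L (IsCMField.complexConj L) N (Matrix.diagonal dV))) :
      GL (Fin N) (AdeleRing (𝓞 L) L)) =
    (toAdeleGL L g)⁻¹ * adelicVal (↥(maximalRealSubfield L)) L (IsCMField.complexConj L) N H k * toAdeleGL L g)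
  {μA : Measure (adelicGroupData (↥(maximalRealSubfield L)) L (IsCMField.complexConj L) N H).automorphicQuotient}
  [(adelicGroupData (↥(maximalRealSubfield L)) L (IsCMField.complexConj L) N H).IsAutomorphicMeasure μA]
  [CompactSpace (adelicGroupData (↥(maximalRealSubfield L)) L (IsCMField.complexConj L) N H).automorphicQuotient]
  [CompactSpace (↥(UnitaryGroup.adelic (↥(maximalRealSubfield L)) L (IsCMField.complexConj L) N (Matrix.diagonal dV)) ⧸
    (UnitaryGroup.toAdelic (↥(maximalRealSubfield L)) L (IsCMField.complexConj L) N (Matrix.diagonal dV)).range)]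

include hιA hpin

set_option maxHeartbeats 1600000 in
/-- **NODE B THROUGH STEP (5), Hodge-free** (twin of ★ `F0LD2ThetaChiDescent.exists_chi_starProjection_ne_zero_of_holCotForm₂`): a discrete `P` FIXED BY
THE ARCHIMEDEAN CENTRE and meeting the theta lift from `⟨a⟩` along `ιA` meets it AT A GENUINE `χ′ ∈ Chi L⁺ L c̄`: `pr_P [Θ̃_Φ(charCM (chiQuot a χ′)) ∘ ιA] ≠ 0`
(★ `F0LD2ThetaSeamCharacter.MeetsThetaLiftFromLine.exists_charCM_starProjection_ne_zero` + §1). [cite: Liu2021, proof of Prop. 4.13 Case 1 (l. 2131–2137, p. 48); Def. 4.11 (l. 2090)] -/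
theorem exists_chi_starProjection_ne_zero_of_archCentre_fixed
    (P : DiscreteAutomorphicRep (adelicGroupData (↥(maximalRealSubfield L)) L (IsCMField.complexConj L) N H) μA)
    (harch : ∀ (y : ↥(relNormOneInfUnits (↥(maximalRealSubfield L)) L)) (v : P.space.toSubmodule),
      P.space.toContRep (adelicCenter (↥(maximalRealSubfield L)) L (IsCMField.complexConj L) N H
        ((cmAdelicOneEquivRelNormOne L).symm (relNormOneInfToIdeles (↥(maximalRealSubfield L)) L y))) v = v)
    (μ : Literature.NumberTheory.Automorphic.IdeleClassGroup L →ₜ* Circle) (hμ : IsConjugateSymplectic L μ) (a : (↥(maximalRealSubfield L))ˣ)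
    (hmeets : MeetsThetaLiftFromLine L N H e₁ dV hdV hdV0 P μ hμ a ιA) :
    letI : MeasurableSpace (↥(UnitaryGroup.adelic (↥(maximalRealSubfield L)) L (IsCMField.complexConj L) 1 (JW (↥(maximalRealSubfield L)) L a)) ⧸
      (UnitaryGroup.toAdelic (↥(maximalRealSubfield L)) L (IsCMField.complexConj L) 1 (JW (↥(maximalRealSubfield L)) L a)).range) := borel _
    haveI := normal_range_toAdelic_JW L a
    ∃ (hρ : HasThetaMajorants fun
      (p : ↥(UnitaryGroup.adelic (↥(maximalRealSubfield L)) L (IsCMField.complexConj L) N (Matrix.diagonal dV)) ×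
        ↥(UnitaryGroup.adelic (↥(maximalRealSubfield L)) L (IsCMField.complexConj L) 1 (JW (↥(maximalRealSubfield L)) L a)))
        (Φ : piSchwartzBruhat (↥(maximalRealSubfield L)) (Fin n')) =>
        pairRep (↥(maximalRealSubfield L)) L (IsCMField.complexConj L) N 1 e₁ (Matrix.diagonal dV) (JW (↥(maximalRealSubfield L)) L a)
          (chiSplittingLine L e₁ dV hdV hdV0 (toHeckeCharacter L μ) (isUnitary_toHeckeCharacter L μ)
            ((isOscillatorChar_toHeckeCharacter_iff μ).mpr hμ) (TW (↥(maximalRealSubfield L)) a)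
            (isUnit_det_TW (↥(maximalRealSubfield L)) a) (JW (↥(maximalRealSubfield L)) L a) (JW_eq (↥(maximalRealSubfield L)) L a))
          p Φ)
      (μW : Measure (↥(UnitaryGroup.adelic (↥(maximalRealSubfield L)) L (IsCMField.complexConj L) 1 (JW (↥(maximalRealSubfield L)) L a)) ⧸
        (UnitaryGroup.toAdelic (↥(maximalRealSubfield L)) L (IsCMField.complexConj L) 1 (JW (↥(maximalRealSubfield L)) L a)).range))
      (_ : IsFiniteMeasure μW)
      (_ : SMulInvariantMeasure ↥(UnitaryGroup.adelic (↥(maximalRealSubfield L)) L (IsCMField.complexConj L) 1 (JW (↥(maximalRealSubfield L)) L a))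
        (↥(UnitaryGroup.adelic (↥(maximalRealSubfield L)) L (IsCMField.complexConj L) 1 (JW (↥(maximalRealSubfield L)) L a)) ⧸
          (UnitaryGroup.toAdelic (↥(maximalRealSubfield L)) L (IsCMField.complexConj L) 1 (JW (↥(maximalRealSubfield L)) L a)).range) μW)
      (Φ : piSchwartzBruhat (↥(maximalRealSubfield L)) (Fin n')) (χ : Chi (↥(maximalRealSubfield L)) L (IsCMField.complexConj L))
      (hθ : MemLp (toQuotFun (adelicGroupData (↥(maximalRealSubfield L)) L (IsCMField.complexConj L) N H) fun x =>
        (lineThetaKernelDatum L N e₁ dV hdV hdV0 μ hμ a hρ).thetaLiftFun μW Φ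
          (charCM (chiQuot (↥(maximalRealSubfield L)) L (IsCMField.complexConj L) (Algebra.IsQuadraticExtension.finrank_eq_two _ L)
            (IsCMField.complexConj_ne_one (K := L)) a χ)) (ιA x)) 2 μA),
      P.space.toSubmodule.starProjection (MemLp.toLp _ hθ) ≠ 0 := by
  letI : MeasurableSpace (↥(UnitaryGroup.adelic (↥(maximalRealSubfield L)) L (IsCMField.complexConj L) 1 (JW (↥(maximalRealSubfield L)) L a)) ⧸
      (UnitaryGroup.toAdelic (↥(maximalRealSubfield L)) L (IsCMField.complexConj L) 1 (JW (↥(maximalRealSubfield L)) L a)).range) := borel _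
  haveI : BorelSpace (↥(UnitaryGroup.adelic (↥(maximalRealSubfield L)) L (IsCMField.complexConj L) 1 (JW (↥(maximalRealSubfield L)) L a)) ⧸
      (UnitaryGroup.toAdelic (↥(maximalRealSubfield L)) L (IsCMField.complexConj L) 1 (JW (↥(maximalRealSubfield L)) L a)).range) := ⟨rfl⟩
  haveI := normal_range_toAdelic_JW L a
  have hιArat : ∀ γ : (adelicGroupData (↥(maximalRealSubfield L)) L (IsCMField.complexConj L) N H).Rational,
      ιA ((adelicGroupData (↥(maximalRealSubfield L)) L (IsCMField.complexConj L) N H).toAdelic γ) ∈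
        (UnitaryGroup.toAdelic (↥(maximalRealSubfield L)) L (IsCMField.complexConj L) N (Matrix.diagonal dV)).range :=
    fun γ => hιA.2 ⟨γ, rfl⟩
  obtain ⟨hρ, μW, hfin, hinv, Φ, ξ, hθ, hξ⟩ :=
    MeetsThetaLiftFromLine.exists_charCM_starProjection_ne_zero L N H e₁ dV hdV hdV0 ιA hιA P μ hμ a hmeets
  obtain ⟨χ', hχ'⟩ :=
    exists_chi_chiQuot_eq_of_archCentre_fixed L N H e₁ dV hdV hdV0 g μ hμ a hρ ιA hpin hιArat μW Φ μA P harch ξ hθ hξ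
  subst hχ'
  exact ⟨hρ, μW, hfin, hinv, Φ, χ', hθ, hξ⟩

end Seam
/-! ## §3 Organ B₂ WITHOUT the Hodge type (`N = 2`): the θ-type finite component of a discrete `P` fixed by the archimedean centre -/
/-- `2 ≤ n'` for `e₁ : Fin 2 × Fin 1 ≃ Fin n'` (`n' = 2`; the rank hypothesis of ★ `isIrreducibleOrZero_rhoVAtLine_chiSplittingLine`). [folklore] -/
private theorem two_le_of_equiv_fin_two {n' : ℕ} (e₁ : Fin 2 × Fin 1 ≃ Fin n') : 2 ≤ n' := by
  have h := Fintype.card_congr e₁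
  simp only [Fintype.card_prod, Fintype.card_fin] at h
  omega

set_option maxHeartbeats 3200000 in
/-- **ROAD O brick (δ): ORGAN B₂ `ThetaFinComponent₂` WITHOUT THE HODGE TYPE.**  In the curve letters' frame (`L` CM with `4 ≤ [L:ℚ]`, `ι`, scaled rational
frame `formCongr c g (t • H) = diag dV` definite at the complex places `≠ ι`, pinned transport `↑(ιA k) = g_𝔸⁻¹ k g_𝔸`): if the discrete `P` of `U(H)` MEETS the
theta lift from the line `⟨a′⟩` at the `μ′`-splitting along `ιA` and is FIXED POINTWISE BY THE ARCHIMEDEAN CENTRE `(y,1)·1₂` (`y ∈ U(1)(L⁺ ⊗ ℝ)`), then for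
some `χ′ ∈ Chi L⁺ L c̄` the finite carrier `ω(μ′, ε_{a′}, χ′)_f` is NON-ZERO and `P.HasFinComponent (ω(μ′, ε_{a′}, χ′)_f ∘ (finAdelicCongr … g ht hg).symm)` —
the conclusion of ★ `F0LD2ThetaFinComponent.thetaFinComponent₂_holds` token for token, its binder `P.IsHolCotangentAt₂ … 𝔣` replaced by the one consequence
B₂ uses (★ `centralCharacter_archCentre_eq_one₂`); so it applies to closed theta spans and orthogonal copies of a holomorphic `P` (ROAD O).
[cite: Liu2021, App. B proof of Cor. B.6 (3) (p. 99); App. D §D.1 Step 3 (l. 5221); proof of Prop. 4.13 Case 1 (l. 2136–2137, p. 48); Def. 4.11 (l. 2092–2096);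
App. D Lemma D.1 (l. 5227)] [cite: Rallis1984, Thm. 1.2.2 proof p. 356] [cite: GelbartRogawski1991, §3.2 p. 457] [cite: BorelJacquet1979, §4.6] -/
theorem thetaFinComponent₂_of_archCentre_fixed :
  ∀ (L : Type) [Field L] [NumberField L] [IsCMField L] (ι : L →+* ℂ) (H : Matrix (Fin 2) (Fin 2) L)
    (dV : Fin 2 → L) (hdV : ∀ i, IsCMField.complexConj L (dV i) = dV i) (hdV0 : ∀ i, dV i ≠ 0)
    (t : L) (ht : t ≠ 0) (g : GL (Fin 2) L)
    (hg : formCongr ((IsCMField.complexConj L : L ≃ₐ[↥(maximalRealSubfield L)] L) : L →+* L) g (t • H) = Matrix.diagonal dV),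
    (∀ τ' : L →+* ℂ, InfinitePlace.mk τ' ≠ InfinitePlace.mk ι → ((Matrix.diagonal dV).map τ').PosDef) →
    4 ≤ Module.finrank ℚ L →
    ∀ (μ : Measure (adelicGroupData (↥(maximalRealSubfield L)) L (IsCMField.complexConj L) 2 H).automorphicQuotient)
      [(adelicGroupData (↥(maximalRealSubfield L)) L (IsCMField.complexConj L) 2 H).IsAutomorphicMeasure μ]
      {n' : ℕ} (e₁ : Fin 2 × Fin 1 ≃ Fin n')
      (ιA : (adelicGroupData (↥(maximalRealSubfield L)) L (IsCMField.complexConj L) 2 H).Adelic →*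
        ↥(UnitaryGroup.adelic (↥(maximalRealSubfield L)) L (IsCMField.complexConj L) 2 (Matrix.diagonal dV))),
      (∀ k, ((ιA k : ↥(UnitaryGroup.adelic (↥(maximalRealSubfield L)) L (IsCMField.complexConj L) 2 (Matrix.diagonal dV))) :
            GL (Fin 2) (AdeleRing (𝓞 L) L)) =
          (toAdeleGL L g)⁻¹ * adelicVal (↥(maximalRealSubfield L)) L (IsCMField.complexConj L) 2 H k * toAdeleGL L g) →
    ∀ [CompactSpace (↥(UnitaryGroup.adelic (↥(maximalRealSubfield L)) L (IsCMField.complexConj L) 2 (Matrix.diagonal dV)) ⧸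
        (UnitaryGroup.toAdelic (↥(maximalRealSubfield L)) L (IsCMField.complexConj L) 2 (Matrix.diagonal dV)).range)],
    ∀ (P : DiscreteAutomorphicRep (adelicGroupData (↥(maximalRealSubfield L)) L (IsCMField.complexConj L) 2 H) μ)
      (μ' : Literature.NumberTheory.Automorphic.IdeleClassGroup L →ₜ* Circle) (hμ' : IsConjugateSymplectic L μ')
      (a' : (↥(maximalRealSubfield L))ˣ),
      MeetsThetaLiftFromLine L 2 H e₁ dV hdV hdV0 P μ' hμ' a' ιA →
      (∀ (y : ↥(relNormOneInfUnits (↥(maximalRealSubfield L)) L)) (v : P.space.toSubmodule),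
        P.space.toContRep (adelicCenter (↥(maximalRealSubfield L)) L (IsCMField.complexConj L) 2 H
          ((cmAdelicOneEquivRelNormOne L).symm (relNormOneInfToIdeles (↥(maximalRealSubfield L)) L y))) v = v) →
      ∃ χ' : Chi (↥(maximalRealSubfield L)) L (IsCMField.complexConj L),
        Nontrivial
          (omegaAtLine (↥(maximalRealSubfield L)) L (IsCMField.complexConj L) 2 e₁ (Matrix.diagonal dV)
            (complexConj_imagUnit L) (imagUnit_ne_zero L) (imagUnit_mul_self L) (realDiagonal_isSymm L dV hdV)
            (isUnit_det_realDiagonal L dV hdV hdV0) (realDiagonal_map L dV hdV).symm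
            (fun a => isCompatible_chiSplittingLine L e₁ dV hdV hdV0 (toHeckeCharacter L μ')
              (isUnitary_toHeckeCharacter L μ') ((isOscillatorChar_toHeckeCharacter_iff μ').mpr hμ')
              (TW (↥(maximalRealSubfield L)) a) (isSymm_TW (↥(maximalRealSubfield L)) a)
              (isUnit_det_TW (↥(maximalRealSubfield L)) a) (JW (↥(maximalRealSubfield L)) L a)
              (JW_eq (↥(maximalRealSubfield L)) L a)) a' χ') ∧
        P.HasFinComponent
          ((rhoVAtLine (↥(maximalRealSubfield L)) L (IsCMField.complexConj L) 2 e₁ (Matrix.diagonal dV)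
              (complexConj_imagUnit L) (imagUnit_ne_zero L) (imagUnit_mul_self L) (realDiagonal_isSymm L dV hdV)
              (isUnit_det_realDiagonal L dV hdV hdV0) (realDiagonal_map L dV hdV).symm
              (fun a => isCompatible_chiSplittingLine L e₁ dV hdV hdV0 (toHeckeCharacter L μ')
                (isUnitary_toHeckeCharacter L μ') ((isOscillatorChar_toHeckeCharacter_iff μ').mpr hμ')
                (TW (↥(maximalRealSubfield L)) a) (isSymm_TW (↥(maximalRealSubfield L)) a)
                (isUnit_det_TW (↥(maximalRealSubfield L)) a) (JW (↥(maximalRealSubfield L)) L a)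
                (JW_eq (↥(maximalRealSubfield L)) L a)) a' χ').comp
            (finAdelicCongr (↥(maximalRealSubfield L)) L (IsCMField.complexConj L) g ht hg).symm.toMonoidHom) := by
  intro L _ _ _ ι H dV hdV hdV0 t ht g hg hpos h4 μ _ n' e₁ ιA hpin _ P μ' hμ' a' hmeets harch
  -- 1. `[U(H)]` is compact
  haveI : CompactSpace (adelicGroupData (↥(maximalRealSubfield L)) L (IsCMField.complexConj L) 2 H).automorphicQuotient := by
    obtain ⟨τ, hτ⟩ := UnitaryGroup.exists_infinitePlace_ne L h4 ι
    exact UnitaryGroup.compactSpace_adelicGroupData_automorphicQuotient L 2 H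
      (UnitaryGroup.anisotropic_of_formCongr_smul_eq_of_posDef L 2 H dV t ht g hg τ (hpos τ hτ))
  -- 2. the pinned transport: continuous, rational-to-rational, finite-adelic on finite-adelic points
  have hιA : Continuous ιA ∧ ∀ ⦃γ : (adelicGroupData (↥(maximalRealSubfield L)) L (IsCMField.complexConj L) 2 H).Adelic⦄,
      γ ∈ (UnitaryGroup.toAdelic (↥(maximalRealSubfield L)) L (IsCMField.complexConj L) 2 H).range →
        ιA γ ∈ (UnitaryGroup.toAdelic (↥(maximalRealSubfield L)) L (IsCMField.complexConj L) 2 (Matrix.diagonal dV)).range :=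
    ⟨continuous_of_pin L 2 H dV g ιA hpin, fun _ hγ => mem_range_toAdelic_of_pin L 2 H dV t ht g hg ιA hpin hγ⟩
  have hιAf : ∀ k, ιA (finAdelicToAdelic (↥(maximalRealSubfield L)) L (IsCMField.complexConj L) 2 H k) =
      finAdelicToAdelic (↥(maximalRealSubfield L)) L (IsCMField.complexConj L) 2 (Matrix.diagonal dV)
        (finPart (↥(maximalRealSubfield L)) L (IsCMField.complexConj L) 2 (Matrix.diagonal dV)
          (ιA (finAdelicToAdelic (↥(maximalRealSubfield L)) L (IsCMField.complexConj L) 2 H k))) := fun k => by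
    rw [finPart_pin_eq_finAdelicCongr_symm L 2 H dV t ht g hg ιA hpin k]
    exact pin_finAdelicToAdelic L 2 H dV t ht g hg ιA hpin k
  have hιV : (finPart (↥(maximalRealSubfield L)) L (IsCMField.complexConj L) 2 (Matrix.diagonal dV)).comp
        (ιA.comp (finAdelicToAdelic (↥(maximalRealSubfield L)) L (IsCMField.complexConj L) 2 H)) =
      (finAdelicCongr (↥(maximalRealSubfield L)) L (IsCMField.complexConj L) g ht hg).symm.toMonoidHom :=
    MonoidHom.ext fun k => by
      show finPart (↥(maximalRealSubfield L)) L (IsCMField.complexConj L) 2 (Matrix.diagonal dV)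
          (ιA (finAdelicToAdelic (↥(maximalRealSubfield L)) L (IsCMField.complexConj L) 2 H k)) =
        (finAdelicCongr (↥(maximalRealSubfield L)) L (IsCMField.complexConj L) g ht hg).symm k
      exact finPart_pin_eq_finAdelicCongr_symm L 2 H dV t ht g hg ιA hpin k
  have hsurj : Function.Surjective ((finPart (↥(maximalRealSubfield L)) L (IsCMField.complexConj L) 2 (Matrix.diagonal dV)).comp
      (ιA.comp (finAdelicToAdelic (↥(maximalRealSubfield L)) L (IsCMField.complexConj L) 2 H))) := by
    rw [hιV]
    exact (finAdelicCongr (↥(maximalRealSubfield L)) L (IsCMField.complexConj L) g ht hg).symm.surjective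
  letI : MeasurableSpace (↥(UnitaryGroup.adelic (↥(maximalRealSubfield L)) L (IsCMField.complexConj L) 1 (JW (↥(maximalRealSubfield L)) L a')) ⧸
      (UnitaryGroup.toAdelic (↥(maximalRealSubfield L)) L (IsCMField.complexConj L) 1 (JW (↥(maximalRealSubfield L)) L a')).range) := borel _
  haveI : BorelSpace (↥(UnitaryGroup.adelic (↥(maximalRealSubfield L)) L (IsCMField.complexConj L) 1 (JW (↥(maximalRealSubfield L)) L a')) ⧸
      (UnitaryGroup.toAdelic (↥(maximalRealSubfield L)) L (IsCMField.complexConj L) 1 (JW (↥(maximalRealSubfield L)) L a')).range) := ⟨rfl⟩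
  haveI := normal_range_toAdelic_JW L a'
  obtain ⟨hρ, μW, hfinm, hinv, Φ, χ', hθ, hχ⟩ :=
    exists_chi_starProjection_ne_zero_of_archCentre_fixed L 2 H e₁ dV hdV hdV0 g ιA hιA hpin P harch μ' hμ' a' hmeets
  haveI : IsFiniteMeasure μW := hfinm
  haveI : SMulInvariantMeasure ↥(UnitaryGroup.adelic (↥(maximalRealSubfield L)) L (IsCMField.complexConj L) 1 (JW (↥(maximalRealSubfield L)) L a'))
      (↥(UnitaryGroup.adelic (↥(maximalRealSubfield L)) L (IsCMField.complexConj L) 1 (JW (↥(maximalRealSubfield L)) L a')) ⧸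
        (UnitaryGroup.toAdelic (↥(maximalRealSubfield L)) L (IsCMField.complexConj L) 1 (JW (↥(maximalRealSubfield L)) L a')).range) μW := hinv
  -- the seam's `MemLp` witness is proof-irrelevant: read it as the uniform one, then reduce to a PURE TENSOR `Φ_∞ ⊗ Φ_f`
  have hχ' : (P.space.toSubmodule.starProjection : Lp ℂ 2 μ →ₗ[ℂ] Lp ℂ 2 μ)
      (MemLp.toLp _ (memLp_toQuotFun_lineThetaLift L 2 H e₁ dV hdV hdV0 ιA hιA μ' hμ' a' hρ μW Φ
        (charCM (chiQuot (↥(maximalRealSubfield L)) L (IsCMField.complexConj L) (Algebra.IsQuadraticExtension.finrank_eq_two _ L)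
          (IsCMField.complexConj_ne_one (K := L)) a' χ')) μ 2)) ≠ 0 := hχ
  obtain ⟨Φinf, Φfin, hfin, hneT⟩ := exists_tensor_of_apply_toLp_lineThetaLift_ne_zero L 2 H e₁ dV hdV hdV0 ιA hιA μ' hμ' a' hρ μW
    (charCM (chiQuot (↥(maximalRealSubfield L)) L (IsCMField.complexConj L) (Algebra.IsQuadraticExtension.finrank_eq_two _ L)
      (IsCMField.complexConj_ne_one (K := L)) a' χ')) μ
    (P.space.toSubmodule.starProjection : Lp ℂ 2 μ →ₗ[ℂ] Lp ℂ 2 μ) Φ hχ'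
  -- the witness `Φ_∞ ⊗ Φ_f`, read in the Kronecker currency of the finite Weil representation
  have hΨ : piSBReindex (↥(maximalRealSubfield L)) e₁ (piSchwartzBruhatEquiv (↥(maximalRealSubfield L)) (Fin 2 × Fin 1)
        (schwartzReindexCLM (↥(maximalRealSubfield L)) e₁.symm Φinf ⊗ₜ[ℂ] finSBReindex (↥(maximalRealSubfield L)) e₁.symm ⟨Φfin, hfin⟩)) =
      ⟨fun v => Φinf (piArch (↥(maximalRealSubfield L)) (Fin n') v) * Φfin (piFinite (↥(maximalRealSubfield L)) (Fin n') v),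
        tensor_mem_piSchwartzBruhat Φinf hfin⟩ := by
    rw [piSBReindex_tmul, schwartzReindexCLM_schwartzReindexCLM_symm, ← finSBReindex_symm, LinearEquiv.apply_symm_apply]
    exact Subtype.ext (coe_piSchwartzBruhatEquiv_tmul (↥(maximalRealSubfield L)) (Fin n') Φinf ⟨Φfin, hfin⟩)
  -- 5. the finite theta intertwiner, non-zero at `mk Φ_f`, from an irreducible-or-zero source
  obtain ⟨θ, hθv⟩ := exists_intertwiningMap_rhoAtLine_finRep L 2 H e₁ dV hdV hdV0 ιA hιA μ' hμ' a' hρ μW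
    (schwartzReindexCLM (↥(maximalRealSubfield L)) e₁.symm Φinf) P χ' hιAf
  have hw : θ (TwistedCoinv.mk _ _ (finSBReindex (↥(maximalRealSubfield L)) e₁.symm ⟨Φfin, hfin⟩)) ≠ 0 := by
    intro h0
    apply hneT
    have h1 := hθv (finSBReindex (↥(maximalRealSubfield L)) e₁.symm ⟨Φfin, hfin⟩)
    rw [h0, toLp_lineThetaLift_congr L 2 H e₁ dV hdV hdV0 ιA hιA μ' hμ' a' hρ μW _ μ hΨ] at h1
    exact h1.symm.trans (ZeroMemClass.coe_zero _)
  have hirr := isIrreducibleOrZero_rhoVAtLine_chiSplittingLine_comp_of_surjective L e₁ (two_le_of_equiv_fin_two e₁) dV hdV hdV0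
    (toHeckeCharacter L μ') (isUnitary_toHeckeCharacter L μ') ((isOscillatorChar_toHeckeCharacter_iff μ').mpr hμ') a' χ' _ hsurj
  have key := P.hasFinComponent_of_isIrreducibleOrZero hirr θ hw
  obtain ⟨x, hx⟩ : ∃ x, θ x ≠ 0 := ⟨_, hw⟩
  have hx0 : x ≠ 0 := fun h0 => hx (by rw [h0, map_zero])
  -- `finPart ∘ ιA ∘ (1,·) = (finAdelicCongr … g ht hg).symm`
  have key' : P.HasFinComponent
      ((rhoVAtLine (↥(maximalRealSubfield L)) L (IsCMField.complexConj L) 2 e₁ (Matrix.diagonal dV)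
          (complexConj_imagUnit L) (imagUnit_ne_zero L) (imagUnit_mul_self L) (realDiagonal_isSymm L dV hdV)
          (isUnit_det_realDiagonal L dV hdV hdV0) (realDiagonal_map L dV hdV).symm
          (fun a => isCompatible_chiSplittingLine L e₁ dV hdV hdV0 (toHeckeCharacter L μ')
            (isUnitary_toHeckeCharacter L μ') ((isOscillatorChar_toHeckeCharacter_iff μ').mpr hμ')
            (TW (↥(maximalRealSubfield L)) a) (isSymm_TW (↥(maximalRealSubfield L)) a)
            (isUnit_det_TW (↥(maximalRealSubfield L)) a) (JW (↥(maximalRealSubfield L)) L a)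
            (JW_eq (↥(maximalRealSubfield L)) L a)) a' χ').comp
        ((finPart (↥(maximalRealSubfield L)) L (IsCMField.complexConj L) 2 (Matrix.diagonal dV)).comp
          (ιA.comp (finAdelicToAdelic (↥(maximalRealSubfield L)) L (IsCMField.complexConj L) 2 H)))) := key
  rw [hιV] at key'
  exact ⟨χ', nontrivial_of_ne x 0 hx0, key'⟩

end Summit.HodgeConjecture.HodgeConjecture.Cruxes.HLiu418.F0LD2ThetaFinComponentOfArchCentre

end
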